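import Mathlib
import Summits.Ventures.PercRepro2.Defs
import Summits.Ventures.PercRepro2.CoinDefs
import Summits.Ventures.PercRepro2.CoinLsmCoreDefs
import Summits.Ventures.PercRepro2.CoinLsmCoreU
import Summits.Ventures.PercRepro2.CoinCoreGate
import Summits.Ventures.PercRepro2.CoinOrTailKDefs
import Summits.Ventures.PercRepro2.CoinOrTailKSums
import Summits.Ventures.PercRepro2.CoinOrTailKCore
import Summits.Ventures.PercRepro2.CoinOrTailLsmCore
import Summits.Ventures.PercRepro2.CoinK2HeadBlindVals
import Summits.Ventures.PercRepro2.CoinK2HeadAwareAD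
import Summits.Ventures.PercRepro2.CoinTreeCore
import Summits.Ventures.PercRepro2.CoinKSureGate
import Summits.Ventures.PercRepro2.CoinKSureCore

/-!
# Row 2′DARC with a MARKER AT THE TAIL — the sums and the functional (blind cell PercRepro2,
night-2 g15; proofs/NIGHT2-DARC.md §51)

Every theorem of the OR-tail theory (§35–§50) places the two markers `a, b` of row 2′DARC in
the core `U`.  Here one marker (or both) is the OR-vertex `a` itself — the tail of the free
arc: `X = 1[a ∈ S⁺]`.  With SURE entry coins `a ∈ S⁺` iff the core level meets the entry set,
so `X` is the INCREASING function `W ↦ 1[W ∩ ent ≠ ∅]` of the core level, and the abstract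
theorem `gate_functional_nonneg` (§49.5) takes arbitrary increasing markers:

* `orTailKSure_functional_nonneg_markers` — `orTailKSure_functional_nonneg` for ARBITRARY
  nonnegative increasing marker functions `x, y` on the core lattice;
* `OrTailK.sum_R_eq_tail` / `sum_G_eq_tail` — the core sums over `U ∪ {a}` with a marker that
  vanishes off `a` reduce to sums over `U` of the TAIL values `rValKa = (1 − tailWtK)·A(W ∪ {a})`
  and `gValKa = (1 − tailWtK)·A(W ∪ {a, w})` (every coin probability);
* with sure coins `rValKa = rValK · 1[W ∩ ent ≠ ∅]` and `gValKa = gValK · 1[W ∩ ent ≠ ∅]`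
  (`rValKa_sure`, `gValKa_sure`), so the functional is the product form of §49 with the marker
  `1[W ∩ ent ≠ ∅]`;
* `darc_of_orTailKSure_tail` (markers `a, m`), `darc_of_orTailKSure_tail'` (markers `m, a`,
  by the marker symmetry `darc_swap`), `darc_of_orTailKSure_tail₂` (both markers at `a`) and
  the out-tree corollaries `darc_of_orTailTreeKSure_tail*`.
-/

namespace Summit.Ventures.PercRepro2.Coin

open Classical

section Swap

variable {V : Type*} {E : Type*} [Fintype E] [DecidableEq E] {R : Type*} [CommRing R]

/-- The cleared functional is symmetric in the two markers. -/
lemma phiC_swap (p : E → R) (arcs : E → Finset (V × V)) (s : V) (T : Finset V) (a b : V)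
    (D : Set (Config E)) : phiC p arcs s T a b D = phiC p arcs s T b a D := by
  have hXY : massE p (fun ω => marker (R := R) arcs s a ω * marker arcs s b ω) D =
      massE p (fun ω => marker (R := R) arcs s b ω * marker arcs s a ω) D := by
    congr 1
    funext ω
    ring
  simp only [phiC]
  rw [hXY]
  ring

/-- Row 2′DARC is symmetric in the two markers. -/
lemma darc_swap [LinearOrder R] (p : E → R) (arcs : E → Finset (V × V)) (s : V) (T : Finset V)
    (a b u w : V) : DARC p arcs s T a b u w ↔ DARC p arcs s T b a u w := by
  unfold DARC
  rw [phiC_swap]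

end Swap

section TailVals

variable {V : Type*} {E : Type*} [DecidableEq V] {R : Type*} [Field R]

/-- The `R`-value of the cluster `W` restricted to «the tail is entered»:
`(1 − tailWtK W) · A (W ∪ {a})`. -/
def rValKa (A : Finset V → R) (pr : E → R) (ent : Finset V) (c : V → E) (a : V)
    (W : Finset V) : R :=
  (1 - tailWtK pr ent c W) * A (W ∪ {a})

/-- The gate value of the cluster `W` restricted to «the tail is entered»:
`(1 − tailWtK W) · A (W ∪ {a, w})`. -/
def gValKa (A : Finset V → R) (pr : E → R) (ent : Finset V) (c : V → E) (a w : V)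
    (W : Finset V) : R :=
  (1 - tailWtK pr ent c W) * A (W ∪ {a, w})

/-- With sure coins the entered `R`-value is the `R`-value times the entry indicator. -/
lemma rValKa_sure (A : Finset V → R) (pr : E → R) {ent : Finset V} (c : V → E) (a : V)
    (hsure : ∀ r ∈ ent, pr (c r) = 1) (W : Finset V) :
    rValKa A pr ent c a W =
      rValK A pr ent c a W * (if ∃ r ∈ ent, r ∈ W then (1 : R) else 0) := by
  unfold rValKa rValK
  rw [tailWtK_sure pr c hsure W]
  split_ifs <;> ring

/-- With sure coins the entered gate value is the gate value times the entry indicator. -/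
lemma gValKa_sure (A : Finset V → R) (pr : E → R) {ent : Finset V} (c : V → E) (a w : V)
    (hsure : ∀ r ∈ ent, pr (c r) = 1) (W : Finset V) :
    gValKa A pr ent c a w W =
      gValK A pr ent c a w W * (if ∃ r ∈ ent, r ∈ W then (1 : R) else 0) := by
  unfold gValKa gValK
  rw [tailWtK_sure pr c hsure W]
  split_ifs <;> ring

end TailVals

section TailSums

variable {V : Type*} {E : Type*} [DecidableEq V] [Fintype E] [DecidableEq E]
  {R : Type*} [Field R]
  {arcs : E → Finset (V × V)} {s : V} {U : Finset V} {ent : Finset V} {c : V → E} {a w : V}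

/-- The `R`-side core sum over `U ∪ {a}` with a marker `g` vanishing off `a` (`g W = 0` when
`a ∉ W`, `g (insert a W) = m W`) is the sum over `U` of the entered `R`-values. -/
lemma OrTailK.sum_R_eq_tail (h : OrTailK arcs s U ent c a) (pr : E → R) (t : V)
    (g m : Finset V → R) (hg0 : ∀ W, a ∉ W → g W = 0)
    (hg1 : ∀ W, a ∉ W → g (insert a W) = m W) :
    ∑ W ∈ (insert a U).powerset, prob pr (coreLevel arcs s (insert a U) W) *
        prob pr (coreAvoidEvent arcs s t (insert a U) W) * g W =
      ∑ W ∈ U.powerset, prob pr (coreLevel arcs s U W) *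
          rValKa (fun X => prob pr (coreAvoidEvent arcs s t (insert a U) X)) pr ent c a W *
            m W := by
  rw [Finset.sum_powerset_insert h.a_notin, ← Finset.sum_add_distrib]
  refine Finset.sum_congr rfl fun W hW => ?_
  have hWU : W ⊆ U := Finset.mem_powerset.1 hW
  have haW : a ∉ W := fun haW => h.a_notin (hWU haW)
  have haE : a ∉ ent := fun he => h.a_notin (h.ent_sub he)
  have hins : insert a W = W ∪ {a} := by rw [Finset.insert_eq, Finset.union_comm]
  rw [hg0 W haW, hg1 W haW, h.prob_coreLevel_eq pr (insert a W),
    h.prob_tailEventK pr (insert a W), Finset.insert_inter_of_notMem h.a_notin,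
    Finset.inter_eq_left.2 hWU, tailWtK_insert_a pr c haE W]
  simp only [rValKa, Finset.mem_insert_self, if_true, mul_zero, zero_add]
  rw [hins]
  ring

/-- The gate-side core sum over `U ∪ {a}` with a marker vanishing off `a` is the sum over `U`
of the entered gate values. -/
lemma OrTailK.sum_G_eq_tail (h : OrTailK arcs s U ent c a) (pr : E → R) (t : V)
    (g m : Finset V → R) (hg0 : ∀ W, a ∉ W → g W = 0)
    (hg1 : ∀ W, a ∉ W → g (insert a W) = m W) :
    ∑ W ∈ (insert a U).powerset, prob pr (coreLevel arcs s (insert a U) W) *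
        prob pr (coreAvoidEvent arcs s t (insert a U) (starTarget a w W)) * g W =
      ∑ W ∈ U.powerset, prob pr (coreLevel arcs s U W) *
          gValKa (fun X => prob pr (coreAvoidEvent arcs s t (insert a U) X)) pr ent c a w W *
            m W := by
  rw [Finset.sum_powerset_insert h.a_notin, ← Finset.sum_add_distrib]
  refine Finset.sum_congr rfl fun W hW => ?_
  have hWU : W ⊆ U := Finset.mem_powerset.1 hW
  have haW : a ∉ W := fun haW => h.a_notin (hWU haW)
  have haE : a ∉ ent := fun he => h.a_notin (h.ent_sub he)
  have hsw : insert w (insert a W) = W ∪ {a, w} := by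
    ext x
    simp only [Finset.mem_insert, Finset.mem_union, Finset.mem_singleton]
    tauto
  have hst2 : starTarget a w (insert a W) = W ∪ {a, w} := by
    simp only [starTarget, Finset.mem_insert_self, if_true]
    exact hsw
  rw [hg0 W haW, hg1 W haW, h.prob_coreLevel_eq pr (insert a W),
    h.prob_tailEventK pr (insert a W), Finset.insert_inter_of_notMem h.a_notin,
    Finset.inter_eq_left.2 hWU, hst2, tailWtK_insert_a pr c haE W]
  simp only [gValKa, Finset.mem_insert_self, if_true, mul_zero, zero_add]
  ring

end TailSums

section MarkersFunctional

variable {V : Type*} {E : Type*} [Fintype V] [DecidableEq V] {R : Type*} [Field R] [LinearOrder R]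
  [IsStrictOrderedRing R]

/-- **The OR-tail functional with any set of sure entries is nonnegative for ARBITRARY
nonnegative increasing markers** `x, y` on the core lattice (the proof of
`orTailKSure_functional_nonneg` with the indicator markers replaced by `x, y`). -/
theorem orTailKSure_functional_nonneg_markers (U : Finset V) (ν A : Finset V → R) (pr : E → R)
    (ent : Finset V) (c : V → E) (a w : V) (x y : Finset V → R)
    (hp0 : ∀ e, 0 ≤ pr e) (hp1 : ∀ e, pr e ≤ 1) (hsure : ∀ r ∈ ent, pr (c r) = 1)
    (hν0 : ∀ W, 0 ≤ ν W) (hν : ∀ s ⊆ U, ∀ t ⊆ U, ν s * ν t ≤ ν (s ∩ t) * ν (s ∪ t))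
    (hA0 : ∀ W, 0 ≤ A W) (hA : ∀ s t : Finset V, A s * A t ≤ A (s ∩ t) * A (s ∪ t))
    (hmono : ∀ s t : Finset V, s ⊆ t → A t ≤ A s)
    (hx0 : ∀ W, 0 ≤ x W) (hy0 : ∀ W, 0 ≤ y W)
    (hxm : ∀ s t, x s ≤ x (s ∪ t)) (hym : ∀ s t, y s ≤ y (s ∪ t)) :
    0 ≤ (∑ W ∈ U.powerset, ν W * rValK A pr ent c a W) ^ 2 *
          (∑ W ∈ U.powerset, ν W * gValK A pr ent c a w W * (x W * y W))
        - (∑ W ∈ U.powerset, ν W * rValK A pr ent c a W) *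
          (∑ W ∈ U.powerset, ν W * rValK A pr ent c a W * x W) *
          (∑ W ∈ U.powerset, ν W * gValK A pr ent c a w W * y W)
        - (∑ W ∈ U.powerset, ν W * rValK A pr ent c a W) *
          (∑ W ∈ U.powerset, ν W * rValK A pr ent c a W * y W) *
          (∑ W ∈ U.powerset, ν W * gValK A pr ent c a w W * x W)
        + (∑ W ∈ U.powerset, ν W * rValK A pr ent c a W * x W) *
          (∑ W ∈ U.powerset, ν W * rValK A pr ent c a W * y W) *
          (∑ W ∈ U.powerset, ν W * gValK A pr ent c a w W) := by
  have hr0 : ∀ W, 0 ≤ rValK A pr ent c a W := fun W => rValK_nonneg hp0 hp1 hA0 ent c a W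
  have hg0 : ∀ W, 0 ≤ gValK A pr ent c a w W := fun W => gValK_nonneg hp0 hp1 hA0 ent c a w W
  set G : Finset V → R := fun W => ν W * rValK A pr ent c a W with hGdef
  set G' : Finset V → R := fun W => ν W * gValK A pr ent c a w W with hG'def
  have hG0 : ∀ W, 0 ≤ G W := fun W => mul_nonneg (hν0 W) (hr0 W)
  have hG'0 : ∀ W, 0 ≤ G' W := fun W => mul_nonneg (hν0 W) (hg0 W)
  have wLL : ∀ s ⊆ U, ∀ t ⊆ U, G s * G t ≤ G (s ∩ t) * G (s ∪ t) := by
    intro s hs t ht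
    simp only [hGdef]
    calc ν s * rValK A pr ent c a s * (ν t * rValK A pr ent c a t)
        = (ν s * ν t) * (rValK A pr ent c a s * rValK A pr ent c a t) := by ring
      _ ≤ (ν (s ∩ t) * ν (s ∪ t)) *
            (rValK A pr ent c a (s ∩ t) * rValK A pr ent c a (s ∪ t)) :=
          mul_le_mul (hν s hs t ht) (rValK_mul_le_all A pr ent c a hp0 hp1 hA0 hA hmono s t)
            (mul_nonneg (hr0 _) (hr0 _)) (mul_nonneg (hν0 _) (hν0 _))
      _ = _ := by ring
  have wMM : ∀ s ⊆ U, ∀ t ⊆ U, G' s * G' t ≤ G' (s ∩ t) * G' (s ∪ t) := by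
    intro s hs t ht
    simp only [hG'def]
    calc ν s * gValK A pr ent c a w s * (ν t * gValK A pr ent c a w t)
        = (ν s * ν t) * (gValK A pr ent c a w s * gValK A pr ent c a w t) := by ring
      _ ≤ (ν (s ∩ t) * ν (s ∪ t)) *
            (gValK A pr ent c a w (s ∩ t) * gValK A pr ent c a w (s ∪ t)) :=
          mul_le_mul (hν s hs t ht) (gValK_mul_le_all A pr ent c a w hp0 hp1 hA0 hA hmono s t)
            (mul_nonneg (hg0 _) (hg0 _)) (mul_nonneg (hν0 _) (hν0 _))
      _ = _ := by ring
  have wLM : ∀ s ⊆ U, ∀ t ⊆ U, (∃ r ∈ ent, r ∈ t) →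
      G s * G' t ≤ G (s ∩ t) * G' (s ∪ t) := by
    intro s hs t ht hte
    simp only [hGdef, hG'def]
    calc ν s * rValK A pr ent c a s * (ν t * gValK A pr ent c a w t)
        = (ν s * ν t) * (rValK A pr ent c a s * gValK A pr ent c a w t) := by ring
      _ ≤ (ν (s ∩ t) * ν (s ∪ t)) *
            (rValK A pr ent c a (s ∩ t) * gValK A pr ent c a w (s ∪ t)) :=
          mul_le_mul (hν s hs t ht)
            (rValK_mul_gValK_le_of_entry A pr c a w hsure hA0 hA hmono hte)
            (mul_nonneg (hr0 _) (hg0 _)) (mul_nonneg (hν0 _) (hν0 _))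
      _ = _ := by ring
  have wML : ∀ s ⊆ U, ∀ t ⊆ U, (∃ r ∈ ent, r ∈ s) →
      G' s * G t ≤ G (s ∩ t) * G' (s ∪ t) := by
    intro s hs t ht hse
    have := wLM t ht s hs hse
    rw [Finset.inter_comm, Finset.union_comm, mul_comm] at this
    exact this
  have hI : ∀ W, W ∩ ent = ∅ → G' W = G W := by
    intro W hW
    have hno : ∀ r ∈ ent, r ∉ W := by
      intro r hr hrW
      have : r ∈ W ∩ ent := Finset.mem_inter.mpr ⟨hrW, hr⟩
      rw [hW] at this
      exact Finset.notMem_empty r this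
    simp only [hGdef, hG'def]
    rw [gValK_eq_rValK_of_no_entry A pr c a w hno]
  exact gate_functional_nonneg U ent G G' x y hG0 hG'0 hx0 hy0 hxm hym wLL wMM wML hI

end MarkersFunctional

section TailMain

variable {V : Type*} {E : Type*} [Fintype V] [DecidableEq V] [Fintype E] [DecidableEq E]
  {R : Type*} [Field R] [LinearOrder R] [IsStrictOrderedRing R]
  {arcs : E → Finset (V × V)} {s : V} {U : Finset V} {ent : Finset V} {c : V → E} {a w : V}

/-- The entry indicator on the core lattice: `1[W ∩ ent ≠ ∅]`. -/
noncomputable def entInd (ent : Finset V) (W : Finset V) : R :=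
  if ∃ r ∈ ent, r ∈ W then 1 else 0

omit [Fintype V] [Fintype E] [DecidableEq E] in
/-- The entry indicator is nonnegative. -/
lemma entInd_nonneg (ent W : Finset V) : (0 : R) ≤ entInd ent W := by
  unfold entInd; split_ifs <;> norm_num

omit [Fintype V] [Fintype E] [DecidableEq E] in
/-- The entry indicator is increasing. -/
lemma entInd_mono (ent s t : Finset V) : (entInd ent s : R) ≤ entInd ent (s ∪ t) := by
  unfold entInd
  by_cases h : ∃ r ∈ ent, r ∈ s
  · obtain ⟨r, hr, hrs⟩ := h
    rw [if_pos ⟨r, hr, hrs⟩, if_pos ⟨r, hr, Finset.mem_union_left t hrs⟩]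
  · rw [if_neg h]; split_ifs <;> norm_num

omit [Fintype V] [Fintype E] [DecidableEq E] [LinearOrder R] [IsStrictOrderedRing R] in
/-- The entry indicator is idempotent. -/
lemma entInd_mul_self (ent W : Finset V) : (entInd ent W : R) * entInd ent W = entInd ent W := by
  unfold entInd; split_ifs <;> ring

end TailMain

end Summit.Ventures.PercRepro2.Coin
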